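import Summits.Ventures.PercRepro.Night2ThreeTwoGeneric
import Summits.Ventures.PercRepro.Night2SevenFiveResiduesV

/-!
# PercRepro — the cell `(3, 2)` in its OBSTRUCTION form: «no saturated middle target» suffices (night-2, gen 24)

`Night2ThreeTwoGeneric` closed the cell `(3, 2)` under the geometric hypotheses «one fat closure, no thin member
missing exactly three points».  They were used only to show that no middle target is saturated and that the
residual capacity is `≥ 1/60`.  Here the second follows from the first alone, by the discreteness of the layer-1
requests: a middle target has `≤ 2` thin covering preimages requesting `Φ/(m+3)` with `m ≥ 2`, and its capacity is
`1 − k₁·Φ/4 ∈ {1, 17/24, 5/12}`; the largest request sum below `5/12` is `Φ/5 + Φ/7 = 2/5` (the pairs `(2,2)` and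
`(2,3)` are saturated there), so an unsaturated middle target keeps `cap2 ≥ 1/60`.

* `req_eq_of_thin`: the request of a thin member is `Φ/(m + d)`;
* `L1_eq_sum_two_requests_three_two`: at a middle target of the cell, `L1` is a sum of `≤ 2` such requests;
* **`cap2_ge_of_unsat_three_two`**: `L1 S ≤ capS S ⟹ 1/60 ≤ cap2 S` at every middle target of the cell;
* **`localShadowHall_three_two_five_of_unsat`**: a fat 2-cocircuit and «no saturated middle target» give (LI_G) at
  every size; **`shadowHall_seven_five_of_residuesW`**: the `(7, 5)` shadow row modulo `(2, 0)`, `(2, 1)` (as in V) and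
  the EXACT obstruction at `(3, 2)`: a fat non-basis member and a saturated middle target.
-/

namespace PercRepro.Shadow

open Finset PerFlat ThmH

variable {α : Type*} [DecidableEq α] {M : Matroid α} [M.Finite]

/-- The request of a thin member is `Φ/(m + d)`, `m = |G ∖ cl B|`, `d = |E ∖ G|`. -/
theorem req_eq_of_thin {q : ℕ} {G : Finset α} (hG : G ∈ flatsQ M (q + 1)) {B : Finset α}
    (hB : B ∈ thinMembers M q G) :
    req M q B = phiQ q / (((G \ clF M B).card : ℚ) + ((gr M \ G).card : ℚ)) := by
  have hBG : clF M B ⊆ G := (mem_membersIn.1 (mem_thinMembers.1 hB).1).2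
  unfold req
  rw [card_compl_clF_add hG hBG]
  push_cast
  ring

/-- **The two-request arithmetic of the cell `(3, 2)`**: two requests `Φ/(a+3)`, `Φ/(b+3)` with `a, b ≥ 2` whose sum
is `≤ 5/12` sum to `≤ 2/5`. -/
theorem two_requests_le_two_fifths {a b : ℕ} (ha : 2 ≤ a) (hb : 2 ≤ b)
    (h : phiQ 5 / ((a : ℚ) + 3) + phiQ 5 / ((b : ℚ) + 3) ≤ 5 / 12) :
    phiQ 5 / ((a : ℚ) + 3) + phiQ 5 / ((b : ℚ) + 3) ≤ 2 / 5 := by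
  unfold phiQ at h ⊢
  norm_num at h ⊢
  have ha' : (2 : ℚ) ≤ (a : ℚ) := by exact_mod_cast ha
  have hb' : (2 : ℚ) ≤ (b : ℚ) := by exact_mod_cast hb
  have key : ∀ (x : ℕ), 2 ≤ x → (7 / 6 : ℚ) / ((x : ℚ) + 3) ≤ 7 / 30 := by
    intro x hx
    have hx' : (2 : ℚ) ≤ (x : ℚ) := by exact_mod_cast hx
    rw [div_le_iff₀ (by linarith)]
    linarith
  have key4 : ∀ (x : ℕ), 4 ≤ x → (7 / 6 : ℚ) / ((x : ℚ) + 3) ≤ 1 / 6 := by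
    intro x hx
    have hx' : (4 : ℚ) ≤ (x : ℚ) := by exact_mod_cast hx
    rw [div_le_iff₀ (by linarith)]
    linarith
  by_cases ha4 : 4 ≤ a
  · have := key4 a ha4; have := key b hb; linarith
  by_cases hb4 : 4 ≤ b
  · have := key4 b hb4; have := key a ha; linarith
  · push Not at ha4 hb4
    interval_cases a <;> interval_cases b
    · exfalso; norm_num at h
    · exfalso; norm_num at h
    · exfalso; norm_num at h
    · norm_num

open scoped Classical in
/-- **An unsaturated middle target of the cell `(3, 2)` keeps `cap2 ≥ 1/60`.** -/
theorem cap2_ge_of_unsat_three_two {G : Finset α} (hG : G ∈ flatsQ M (5 + 1))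
    (hd : (gr M \ G).card = 3) (hk : kColoops M G = 2)
    (hs : ∀ e ∈ gr M, ∀ f ∈ gr M, e ≠ f → rkN M {e, f} = 2) (hl : ∀ e ∈ gr M, M.Indep {e}) {S : Finset α}
    (hS : S ∈ shadowAt M (5 + 2) 5 (Uq M (5 + 2) 5) G) (hcard : 4 + 1 ≤ (S \ coloops M G).card)
    (hns : L1 M 5 G S ≤ capS M 5 G S) : (1 / 60 : ℚ) ≤ cap2 M 5 G S := by
  have hk' : kColoops M G + 4 = 5 + 1 := by omega
  have hd' : (gr M \ G).card ≤ 5 := by omega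
  have hSG : S ⊆ G := subset_G_of_mem_shadowAt hS
  -- `cap2 = capS − L1` at an unsaturated target
  have hcap2 : cap2 M 5 G S = capS M 5 G S - L1 M 5 G S := by
    unfold cap2 fS
    rw [if_pos hns]; ring
  rw [hcap2]
  -- the capacity is `1 − k₁·Φ/4` with `k₁ ≤ 2`
  have hcapS : capS M 5 G S = 1 - (k1 M 5 G S : ℚ) * phiQ 5 / (1 + ((gr M \ G).card : ℚ)) := rfl
  have hcapS_ge := capS_ge_one_sub_kColoops (q := 5) hd hSG
  rw [hk] at hcapS_ge
  have hk1 : k1 M 5 G S ≤ 2 := by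
    by_contra hcon
    push Not at hcon
    have h3 : (3 : ℚ) ≤ (k1 M 5 G S : ℚ) := by exact_mod_cast hcon
    rw [hcapS, hd] at hcapS_ge
    unfold phiQ at hcapS_ge
    norm_num at hcapS_ge
    linarith
  -- `L1` is a sum of `≤ 2` requests `Φ/(m + 3)`, `m ≥ 2`
  set P := (coverPreimages M (Uq M (5 + 2) 5) G S).filter (fun B => B ∉ lay0 M 5 G) with hP
  have hL1 : L1 M 5 G S = ∑ B ∈ P, req M 5 B := rfl
  have hPcard : P.card + 2 ≤ 4 := card_thin_coverPreimages_add_two_le hG hd' hk' hs hl hS hcard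
  have hthin : ∀ B ∈ P, B ∈ thinMembers M 5 G := by
    intro B hB
    rw [hP, Finset.mem_filter, mem_coverPreimages] at hB
    exact mem_thinMembers.2 ⟨hB.1.1, hB.2⟩
  have hreq : ∀ B ∈ P, req M 5 B = phiQ 5 / (((G \ clF M B).card : ℚ) + 3) := by
    intro B hB
    rw [req_eq_of_thin hG (hthin B hB), hd]; push_cast; ring
  have hm2 : ∀ B ∈ P, 2 ≤ (G \ clF M B).card := fun B hB =>
    two_le_card_sdiff_of_not_lay0 hG hd' (mem_thinMembers.1 (hthin B hB)).1 (mem_thinMembers.1 (hthin B hB)).2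
  have hreq_le : ∀ B ∈ P, req M 5 B ≤ 7 / 30 := by
    intro B hB
    rw [hreq B hB]
    have h2 : (2 : ℚ) ≤ ((G \ clF M B).card : ℚ) := by exact_mod_cast hm2 B hB
    unfold phiQ
    rw [div_le_iff₀ (by linarith)]
    linarith
  -- the bound `L1 ≤ 7/15` (two requests at most) and the sharper `L1 ≤ 2/5` when `capS = 5/12`
  have hL1_le : L1 M 5 G S ≤ 7 / 15 := by
    rw [hL1]
    calc ∑ B ∈ P, req M 5 B ≤ ∑ _B ∈ P, (7 / 30 : ℚ) := Finset.sum_le_sum hreq_le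
      _ = (P.card : ℚ) * (7 / 30) := by rw [Finset.sum_const, nsmul_eq_mul]
      _ ≤ 2 * (7 / 30) := by
          have : (P.card : ℚ) ≤ 2 := by exact_mod_cast (by omega : P.card ≤ 2)
          nlinarith
      _ = 7 / 15 := by norm_num
  rw [hcapS, hd]
  unfold phiQ
  push_cast
  rcases (show k1 M 5 G S = 0 ∨ k1 M 5 G S = 1 ∨ k1 M 5 G S = 2 by omega) with h0 | h1 | h2
  · rw [h0]; push_cast; linarith
  · rw [h1]; push_cast; linarith
  · rw [h2]; push_cast
    -- `capS = 5/12`: the request sum is `≤ 5/12`, hence `≤ 2/5`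
    have hns' : L1 M 5 G S ≤ 5 / 12 := by
      rw [hcapS, hd, h2] at hns; unfold phiQ at hns; push_cast at hns; linarith
    have hL1' : L1 M 5 G S ≤ 2 / 5 := by
      rcases Nat.lt_or_ge P.card 2 with hlt | hge
      · -- at most one request
        have : L1 M 5 G S ≤ (P.card : ℚ) * (7 / 30) := by
          rw [hL1]
          calc ∑ B ∈ P, req M 5 B ≤ ∑ _B ∈ P, (7 / 30 : ℚ) := Finset.sum_le_sum hreq_le
            _ = (P.card : ℚ) * (7 / 30) := by rw [Finset.sum_const, nsmul_eq_mul]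
        have : (P.card : ℚ) ≤ 1 := by exact_mod_cast (by omega : P.card ≤ 1)
        nlinarith
      · have hc2 : P.card = 2 := by omega
        obtain ⟨B₁, B₂, hne, hPeq⟩ := Finset.card_eq_two.1 hc2
        have hB₁ : B₁ ∈ P := by rw [hPeq]; simp
        have hB₂ : B₂ ∈ P := by rw [hPeq]; simp
        rw [hL1, hPeq, Finset.sum_pair hne] at hns' ⊢
        rw [hreq B₁ hB₁, hreq B₂ hB₂] at hns' ⊢
        exact two_requests_le_two_fifths (hm2 B₁ hB₁) (hm2 B₂ hB₂) hns'
    linarith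

open scoped Classical in
/-- **THE CELL `(3, 2)` IN ITS OBSTRUCTION FORM, AT EVERY SIZE**: a fat 2-cocircuit `{p, x}` through the coloops and
«no saturated middle target» give (LI_G). -/
theorem localShadowHall_three_two_five_of_unsat {G : Finset α} (hG : G ∈ flatsQ M (5 + 1))
    (hd : (gr M \ G).card = 3) (hk : kColoops M G = 2)
    (hs : ∀ e ∈ gr M, ∀ f ∈ gr M, e ≠ f → rkN M {e, f} = 2) (hl : ∀ e ∈ gr M, M.Indep {e})
    (hns : ∀ S ∈ shadowAt M (5 + 2) 5 (Uq M (5 + 2) 5) G, 4 + 1 ≤ (S \ coloops M G).card →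
      L1 M 5 G S ≤ capS M 5 G S)
    {p x : α} (hpx : p ≠ x) (hK : ∀ a ∈ ({p, x} : Finset α), a ∉ coloops M G)
    (hH₀ : M.eRk ((G \ {p, x} : Finset α) : Set α) ≤ ((5 : ℕ) : ℕ∞)) :
    LocalShadowHall M 5 G := by
  have hk' : kColoops M G + 4 = 5 + 1 := by omega
  have hd' : (gr M \ G).card ≤ 5 := by omega
  by_cases hn7 : 7 ≤ G.card - kColoops M G
  swap
  · push Not at hn7
    exact localShadowHall_of_lossFair hG hd'
      (fun B hB => absurd (thin_card_bound (ρ := 4) hG hd (by omega) hk' hB) (by omega))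
  have hKG : coloops M G ⊆ G := fun y hy => (mem_coloops.1 hy).1
  have hnK : (G \ coloops M G).card = G.card - kColoops M G := by
    rw [Finset.card_sdiff_of_subset hKG, ← kColoops_eq_card_coloops]
  have hcap : ∀ S ∈ shadowAt M (5 + 2) 5 (Uq M (5 + 2) 5) G, 4 + 1 ≤ (S \ coloops M G).card →
      (1 / 60 : ℚ) ≤ cap2 M 5 G S :=
    fun S hS hcard => cap2_ge_of_unsat_three_two hG hd hk hs hl hS hcard (hns S hS hcard)
  set n := G.card - kColoops M G with hn
  have hc₁ : ({p, x} : Finset α).card = 2 := Finset.card_pair hpx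
  refine localShadowHall_excess_of_count_unsat (d := 3) (ρ := 4) hG hd (by norm_num) hk' (by norm_num) hns
    (c'' := (1 / 60 : ℚ)) (by norm_num) hcap (E := ((n : ℚ) + 56) / (20 * (n : ℚ))) (excess_three_two_pos hn7) ?_
    (cnt := fun s => (cntSeries 4 s [2] : ℚ)) ?_ ?_ ?_
  · intro S _ T hT
    have hT' : T ∈ (S \ coloops M G).powersetCard 4 := by
      unfold coverBases at hT
      exact (Finset.mem_filter.1 hT).1
    have h := sum_faceLoss_union_le (a := ((n : ℚ) + 2) / (5 * (n : ℚ))) (b := 1 / (5 * (n : ℚ))) hG hd (by norm_num)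
      hk' (by omega) hs hl (by positivity) (by rw [hnK]; exact chord_three_two hn7)
      (by rw [hnK, hk, excessBound_three_two_eq hn7]; exact (excess_three_two_pos hn7).le) hT'
    rw [hnK, hk, excessBound_three_two_eq hn7] at h
    exact h
  · intro s h1 _
    exact cntSeries_four_two_pos (by omega)
  · intro S hSG
    have h := card_coverBases_le_cntSeries hk' [({p, x} : Finset α)] (List.pairwise_singleton _ _) ?_ ?_ hSG
    · simpa only [List.map_cons, List.map_nil, hc₁] using h
    · intro C hC
      rw [List.mem_singleton] at hC
      rw [hC, hc₁]; omega
    · intro C hC a ha b hb hab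
      rw [List.mem_singleton] at hC
      rw [hC] at ha hb
      exact ⟨coloops_subset_sdiff_pair (hK a ha) (hK b hb), pair_cocircuit hH₀ a ha b hb hab⟩
  · exact countSum_three_two hn7

section SevenFiveW

variable {α' : Type} [DecidableEq α']

/-- **THE `(7, 5)` SHADOW ROW FOR EVERY FINITE MATROID MODULO THE RESIDUES W**: `(2, 0)`, `(2, 1)` as in the residues V
and, at `(3, 2)`, the exact obstruction — a fat non-basis member and a SATURATED middle target. -/
theorem shadowHall_seven_five_of_residuesW
    (h20 : ∀ (N : Matroid α') [N.Finite] (G : Finset α'), CellHyp N G →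
      (gr N \ G).card = 2 → kColoops N G = 0 → FatMember N G 6 3 →
      (FatBasis N G 6 2 ∨ FatMember N G 6 2) →
      (2 ≤ (fatClosures N 5 G 2).card ∨
        ∃ B ∈ thinMembers N 5 G, 2 < (G \ clF N B).card ∧ (G \ clF N B).card < 5) →
      LocalShadowHall N 5 G)
    (h21 : ∀ (N : Matroid α') [N.Finite] (G : Finset α'), CellHyp N G →
      (gr N \ G).card = 2 → kColoops N G = 1 → FatMember N G 5 4 →
      (FatBasis N G 5 3 ∨ FatMember N G 5 3) →
      (2 ≤ (fatClosures N 5 G 2).card ∨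
        ∃ B ∈ thinMembers N 5 G, 2 < (G \ clF N B).card ∧ (G \ clF N B).card < 7) →
      LocalShadowHall N 5 G)
    (h32 : ∀ (N : Matroid α') [N.Finite] (G : Finset α'), CellHyp N G →
      (gr N \ G).card = 3 → kColoops N G = 2 → FatMember N G 4 2 →
      (∃ S ∈ shadowAt N (5 + 2) 5 (Uq N (5 + 2) 5) G, 4 + 1 ≤ (S \ coloops N G).card ∧
        capS N 5 G S < L1 N 5 G S) →
      LocalShadowHall N 5 G)
    (M : Matroid α') [M.Finite] : ShadowHall M 7 5 (phiK 7 5) := by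
  apply shadowHall_seven_five_of_residuesV h20 h21
  intro N _ G hcell hd hk hfm _hstr
  by_cases hsat : ∃ S ∈ shadowAt N (5 + 2) 5 (Uq N (5 + 2) 5) G, 4 + 1 ≤ (S \ coloops N G).card ∧
      capS N 5 G S < L1 N 5 G S
  · exact h32 N G hcell hd hk hfm hsat
  · push Not at hsat
    have hG := hcell.2.2.2
    have hd' : (gr N \ G).card ≤ 5 := by omega
    obtain ⟨B₀, hB₀, -, hf₀⟩ := hfm
    have hc2 : (G \ clF N B₀).card = 2 := le_antisymm hf₀
      (two_le_card_sdiff_of_not_lay0 hG hd' (mem_thinMembers.1 hB₀).1 (mem_thinMembers.1 hB₀).2)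
    obtain ⟨p, x, hpx, hP⟩ := Finset.card_eq_two.1 hc2
    refine localShadowHall_three_two_five_of_unsat hG hd hk hcell.1 hcell.2.1 (fun S hS hc => hsat S hS hc) hpx ?_ ?_
    · intro a ha
      exact notMem_coloops_of_mem_sdiff_clF hG hd' hB₀ (hP ▸ ha)
    · have := eRk_clF_le_of_mem_thinMembers hB₀
      rwa [clF_eq_sdiff_sdiff_of_thin hB₀, hP] at this

end SevenFiveW

end PercRepro.Shadow
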